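import Mathlib
import HarnessLib
import Literature.Geometry.Lorentzian.BondiBartnikGap

/-!
# Route BartnikGapSettling — support item `SelfCompetitor` (stmt-FinalStateConjecture-10810)

ANTI-VACUITY OF THE COMPETITOR CLASS: every vacuum Cauchy development competes for its own cores.
For a vacuum Cauchy development `𝒟`, a core `C ⊆ 𝒟` and a real `m` with `HasCutBondiMass 𝒟 C m`,
the pair `(U, φ) = (univ, id)` is an open set containing `C` with `φ` smooth on `U`, an open
embedding of `U`, isometric on `U` (`id^* g = g`, `pullbackBilin_id`) and time-orientation
preserving on `U` (`d(id)_q T_q = T_q` is future-directed, `mfderiv_id` and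
`TimeOrientation.isFutureDirected_vectorField`), and `HasCutBondiMass 𝒟 (id '' C) m` because
`id '' C = C`. This is the `(𝒟, univ, id)` case of
`Literature.Geometry.Lorentzian.VacuumCauchyDevelopment.isCompetitor_id`, without the admissibility /
maximality fields (the item does not ask for them).

Design note: this file does NOT import the route module
`Summits.FinalStateConjecture.FinalStateConjecture.Theses.BartnikGapSettling`; the theorem is stated
with the item's term written out verbatim, so that its type is the route decl `SelfCompetitor` by
`δ`-unfolding alone and the gate can render the `SelfCompetitor_holds` link into the route file
without an import cycle.
-/

-- D-0017: single-problem summit, `Summit.<S>.<S>.…` by design (cf. lakefile `weak.linter.dupNamespace`).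
set_option linter.dupNamespace false

namespace Summit.FinalStateConjecture.FinalStateConjecture.Theorems

open scoped BigOperators Topology Manifold Classical MeasureTheory ProbabilityTheory Matrix InnerProductSpace ComplexConjugate ContinuousMap
open Filter Set Function TopologicalSpace MeasureTheory

/-- **The identity competes** (route `BartnikGapSettling`, support item `SelfCompetitor`,
stmt-FinalStateConjecture-10810): for every vacuum Cauchy development `𝒟` of a datum `D` on a
`3`-manifold `X`, every core `C` and real `m` with `𝒟.HasCutBondiMass C m`, there are an open
`U ⊇ C` and `φ : 𝒟 → 𝒟` smooth on `U`, an open embedding of `U`, isometric and future-directed on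
`U`, with `𝒟.HasCutBondiMass (φ '' C) m` — witnessed by `U = univ`, `φ = id`. The type is the
verbatim term of `Summit.FinalStateConjecture.FinalStateConjecture.Theses.BartnikGapSettling.SelfCompetitor`. -/
theorem selfCompetitor_proof :
    (open Literature.Geometry.Lorentzian in ∀ (X : Type) [TopologicalSpace X] [ChartedSpace E3 X] [IsManifold (𝓡 3) ((⊤ : ℕ∞) : WithTop ℕ∞) X] [T2Space X] [SecondCountableTopology X] [ConnectedSpace X], ∀ (D : InitialDataSet (𝓡 3) X) (𝒟 : VacuumCauchyDevelopment D) (C : Set 𝒟.carrier) (m : ℝ), 𝒟.toCauchyDevelopment.HasCutBondiMass C m → ∃ (U : Set 𝒟.carrier) (φ : 𝒟.carrier → 𝒟.carrier), IsOpen U ∧ C ⊆ U ∧ ContMDiffOn (𝓡 4) (𝓡 4) ((⊤ : ℕ∞) : WithTop ℕ∞) φ U ∧ Topology.IsOpenEmbedding (U.restrict φ) ∧ (∀ q ∈ U, pullbackBilin (I := 𝓡 4) (I' := 𝓡 4) φ 𝒟.metric.val q = 𝒟.metric.val q) ∧ (∀ q ∈ U, 𝒟.timeOrientation.IsFutureDirected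 (mfderiv (𝓡 4) (𝓡 4) φ q (𝒟.timeOrientation.vectorField q))) ∧ 𝒟.toCauchyDevelopment.HasCutBondiMass (φ '' C) m) := by
  intro X _ _ _ _ _ _ D 𝒟 C m hm
  refine ⟨univ, id, isOpen_univ, subset_univ C, contMDiffOn_id,
    isOpen_univ.isOpenEmbedding_subtypeVal, fun q _ => ?_, fun q _ => ?_, ?_⟩
  · rw [Literature.Geometry.Lorentzian.pullbackBilin_id]
  · rw [mfderiv_id]
    exact 𝒟.timeOrientation.isFutureDirected_vectorField q
  · simpa only [image_id] using hm

end Summit.FinalStateConjecture.FinalStateConjecture.Theorems
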